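import Mathlib
import Literature.MathematicalPhysics.StatisticalMechanics.StickyWulffConstants
import Literature.MathematicalPhysics.StatisticalMechanics.FccSurfaceTension
import Literature.Barriers.AtomisticToContinuum.LocalizedPotentialsExcludeLennardJones
import HarnessLib

/-!
# Emergence of the Wulff crystal for sticky spheres on the fcc and hcp packings (Cicalese–Kreutz–Leonardi 2023)

Topic `Literature/MathematicalPhysics/StatisticalMechanics`; companions `StickyWulffConstants.lean`
(NAMED FACT `CicaleseKreutzLeonardi2023_surfaceConstants` = Theorem 2.3 + (25), (28) as the convergence
of minimum values, the constants `∛432`, `(3/2)∛130`; `contactDeficiency`), `FccSurfaceTension.lean`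
(`phiFcc = ϕ_FCC/2` (23) and its Wulff body `fccWulffBody`), `BarlowStacking.lean` (`hcpStacking`),
`LocalizedPotentialsExcludeLennardJones.lean` (`FlatleyTheil2015.fccLattice = (b₁ b₂ b₃)ℤ³`, the same
three generators `(0,1,1)/√2, (1,0,1)/√2, (1,1,0)/√2` as the source's (6), (8)), and
`LatticeMaximalFluctuations.lean` (Cicalese–Leonardi 2020).  Cross-ladder literature-typing layer
(D-0088 (4)), cell `crystal3d-full`, seat `littype-FC1-2`.  This file adds what `StickyWulffConstants.lean`
lists under "WHAT IS NOT HERE": the convergence OF THE MINIMISERS THEMSELVES to the Wulff crystal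
(Theorem 2.3 (i), second part = Lemma 5.16), and the printed hcp density (26).

## Source, as printed (M. Cicalese, L. Kreutz, G. P. Leonardi, Comm. Math. Phys. **402** (2023)
2931–2978 = arXiv:2204.12892 [CicaleseKreutzLeonardi2023]; pages of the arXiv text held as
`paper:cicalese2023-emergence-wulff-crystals-from-atomistic-systems-fcc`)

* p. 5, (6)–(9): `b₁ = (1,1,0)/√2`, `b₂ = (1,0,1)/√2`, `b₃ = (0,1,1)/√2`; `e₁ = (1,0,0)`,
  `e₂ = (½, √3/2, 0)`, `e₃ = (2√6/3)(0,0,1)`, `v₁ = ⅓(e₁ + e₂) + ½ e₃`; `L_FCC = span_ℤ{b₁,b₂,b₃}` (8),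
  `L_HCP = span_ℤ{e₁,e₂,e₃} ∪ (span_ℤ{e₁,e₂,e₃} + v₁)` (9); nearest neighbours = points at distance `1`.
* p. 6: `E_L(X, A) = Σ_{x∈X∩A} (12 − #(N(x) ∩ X))`; p. 6–7 (17)–(18): for `X ⊂ εL`,
  `G_{L,ε}(X) = ε² Σ_{x∈X}(12 − #(N_ε(x) ∩ X))`, `μ_ε = ε³ Σ_{x∈X} δ_x`, `E_{L,ε}(μ_ε) = G_{L,ε}(X)`.
* p. 8, (22): for `ϕ` convex, non-degenerate, positively one-homogeneous, the **Wulff set**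
  `W_ϕ = {ζ ∈ ℝⁿ : ⟨ζ, ν⟩ ≤ ϕ(ν) for all ν ∈ S^{n−1}}`; "Given `λ > 0` we set `W_λ = (λ/|W_ϕ|)^{1/n} W_ϕ`
  so that `|W_λ| = λ`".
* p. 8–9, **Theorem 2.3 (i)** (Compactness): "… Furthermore, if `μ_ε` is such that
  `E_{L,ε}(μ_ε) = inf_{ν ∈ M₊(ℝ³): |ν|(ℝ³) = ε³ n_ε} E_{L,ε}(μ)`, with `ε³ n_ε → √2 v`, then
  `μ = √2 𝓛³⌞W^v_{ϕ_L}`, where `W^v_{ϕ_L} = λ W_{ϕ_L}` (defined in (22)) for `λ > 0` such that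
  `|W^v_{ϕ_L}| = v`."  (`μ_ε ⇀* μ`, weak star = against `C_c`, p. 4.)
* p. 36, **Lemma 5.16 (Concentration Lemma)**: "Let `{X_ε}` and `{n_ε} ⊂ ℕ` be such that for all `ε > 0`
  `X_ε ⊂ εL`, `#X_ε = n_ε`, `n_ε εⁿ → ρv` as `ε → 0`, and `F_ε(X_ε) = min_{#X = n_ε} F_ε(X)`. Then, there
  exists `{τ_ε} ⊂ ℝⁿ` such that `τ_ε ∈ ε span_ℤ{e₁,…,eₙ}`, and `μ_ε(· − τ_ε) ⇀* ρ χ_W`, where `W` is the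
  Wulff shape of `ϕ_hom` … such that `|W| = v`."  Here `ρ = #(L ∩ Q)/|Q|` ((76), p. 28): `√2` for both
  `L_FCC` (`|T_FCC| = ½√2`, (29)) and `L_HCP` (`|T_HCP| = √2`, `L_HCP ∩ T_HCP = {0, v₁}`, p. 25); the
  proof of Theorem 2.3 (p. 25–26) applies §5 with periods `b₁,b₂,b₃`, resp. `e₁,e₂,e₃`.
* p. 10, **Proposition 2.5** (26):
  `ϕ_HCP(ν) = √2(|⟨e₁,ν⟩| + |⟨e₂,ν⟩| + |⟨e₁−e₂,ν⟩|) + (1/√2)|⟨e₃,ν⟩| + √2 max{|⟨e₁,ν⟩|, |⟨e₂,ν⟩|, |⟨e₃,ν⟩|, |⟨e₁−e₂,ν⟩|}`;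
  "`W_HCP` is a truncated elongated hexagonal bipyramid".

## Rendering

* Hosts.  `L_FCC` is `FlatleyTheil2015.fccLattice` (verbatim the same generators, in the source's cubic
  frame, in which (23) and the tree's `phiFcc` are written).  `L_HCP` is `hcpStacking 1 √(2/3)`: its layer
  `k` is the unit triangular lattice `ℤ(1,0,0) ⊕ ℤ(½,√3/2,0)` at height `k√(2/3)`, shifted by
  `(½, √3/6, 0)` for odd `k` (`haggLabel_alternating`) — i.e. `span_ℤ{e₁,e₂,e₃} ∪ (… + v₁)` with
  `e₃ = 2√(2/3) e_z = (2√6/3) e_z` and `v₁ = (½, √3/6, √(2/3))`, the source's (9) in the source's frame,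
  in which (26) is written.
* Energies.  `Σ_{x∈X}(12 − #(N(x) ∩ X)) = 2 · contactDeficiency X` (`StickyWulffConstants.lean`), so
  "`μ_ε` minimises `E_{L,ε}` among measures of mass `ε³ n_ε`" is: `X` minimises `contactDeficiency` among
  the `#X`-point subsets of `L` (`IsDeficiencyMinimizer`) — equivalently, maximises the number of contacts.
* Densities in the tree's *deficiency units* (`phiFcc = ϕ_FCC/2`): `phiHcp := ϕ_HCP/2`.  The Wulff set
  scales linearly with the density and only VOLUME-NORMALISED dilates `W^v` enter the statements, so the
  factor `½` is immaterial there.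
* Measures.  The configuration `X_ε ⊂ εL` is `ε • X`, `X ⊂ L` unscaled; `∫ g dμ_ε(· − τ_ε)` with
  `τ_ε = −ε a`, `a` in the period module, is `ε³ Σ_{x∈X} g(ε(x − a))`; weak-star convergence is tested
  against continuous compactly supported `g` (p. 4) and the limit `ρ χ_W 𝓛³` gives `ρ ∫_W g`.  This is
  `EmpiricalMeasuresConvergeTo`.  The translations are taken in `L_FCC = span_ℤ{bᵢ}` itself, resp. in
  `span_ℤ{e₁,e₂,e₃} ⊂ L_HCP`, as printed.

## Contents (namespace `Literature.MathematicalPhysics.StatisticalMechanics`)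

* with bodies: `wulffSet` (22), `volumeDilate` (`W^v`), `hcpE₁/₂/₃`, `hcpV₁` (7), `phiHcp` ((26), halved),
  `IsDeficiencyMinimizer`, `EmpiricalMeasuresConvergeTo`;
* PROVED: `fccWulffBody_subset_wulffSet` (the tree's truncated octahedron lies in `W_{φ_fcc}`, from
  `inner_le_phiFcc_of_mem_fccWulffBody`), `phiHcp_nonneg`, `phiHcp_neg`, `phiHcp_basal` (`φ_hcp(e_z) = √3`,
  the fcc `{111}` value — a check of the transcription of (26)); the `N`-indexed corollaries
  `fccWulffEmergence_nat_of`, `hcpWulffEmergence_nat_of` (`ε_N = (N+1)^{−1/3}`, `v = 1/√2`);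
* NAMED FACTS: `CicaleseKreutzLeonardi2023_fccWulffEmergence`, `CicaleseKreutzLeonardi2023_hcpWulffEmergence`
  (Theorem 2.3 (i) second part with Lemma 5.16's lattice translations, for the two hosts).

WHAT IS NOT HERE: Theorem 2.3 (i) first part (compactness), (ii), (iii) — typed SINCE in
`WulffCrystalGammaLimit.lean` (named facts `CicaleseKreutzLeonardi2023_fccGammaLimit` / `_hcpGammaLimit`,
over the distributional anisotropic perimeter of `Literature/Analysis/Convexity/AnisotropicPerimeter.lean`
in place of reduced boundaries); the general periodic-lattice theory of §5 (Proposition 5.10, Lemma 5.11,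
Theorem 5.14, Lemma 5.15) and the polar formulas (24), (27) — still not typed; the values (25), (28) (in
`StickyWulffConstants.lean`).  The identification `W_{φ_fcc} = fccWulffBody` IS proved below
(`wulffSet_phiFcc_eq_fccWulffBody`, appended).
-/

noncomputable section

open scoped Pointwise RealInnerProductSpace
open MeasureTheory Filter Topology

namespace Literature.MathematicalPhysics.StatisticalMechanics

open Literature.Barriers.AtomisticToContinuum.FlatleyTheil2015 (fccLattice)

/-! ### Wulff sets and their volume-normalised dilates -/

/-- **The Wulff set of a density `ϕ`** (22): `W_ϕ = {ζ ∈ ℝ³ : ⟨ζ, ν⟩ ≤ ϕ(ν) for all ν ∈ S²}`.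
[cite: CicaleseKreutzLeonardi2023, (22), p. 8] -/
def wulffSet (ϕ : EuclideanSpace ℝ (Fin 3) → ℝ) : Set (EuclideanSpace ℝ (Fin 3)) :=
  {ζ | ∀ ν : EuclideanSpace ℝ (Fin 3), ‖ν‖ = 1 → ⟪ζ, ν⟫ ≤ ϕ ν}

/-- The dilate `W^v = (v/|W|)^{1/3} W` of `W ⊂ ℝ³`, of volume `v` when `0 < |W| < ∞` ("Given `λ > 0` we
set `W_λ = (λ/|W_ϕ|)^{1/n} W_ϕ` so that `|W_λ| = λ`"). [cite: CicaleseKreutzLeonardi2023, p. 8] -/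
def volumeDilate (W : Set (EuclideanSpace ℝ (Fin 3))) (v : ℝ) : Set (EuclideanSpace ℝ (Fin 3)) :=
  ((v / (volume W).toReal) ^ ((1 : ℝ) / 3)) • W

/-- The tree's truncated octahedron `fccWulffBody = conv{perm(0,±1,±2)}` lies in the Wulff set of
`φ_fcc` (each of its points pairs against any `ν` to at most `φ_fcc(ν)`,
`inner_le_phiFcc_of_mem_fccWulffBody`). [cite: CicaleseKreutzLeonardi2023, Proposition 2.4 (24), p. 10] -/
theorem fccWulffBody_subset_wulffSet : fccWulffBody ⊆ wulffSet phiFcc :=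
  fun _ hx ν _ => inner_le_phiFcc_of_mem_fccWulffBody ν hx

/-! ### The hcp frame and the printed density (26) -/

/-- `e₁ = (1, 0, 0)` (7). [cite: CicaleseKreutzLeonardi2023, (7), p. 5] -/
def hcpE₁ : EuclideanSpace ℝ (Fin 3) := !₂[1, 0, 0]

/-- `e₂ = (½, √3/2, 0)` (7). [cite: CicaleseKreutzLeonardi2023, (7), p. 5] -/
def hcpE₂ : EuclideanSpace ℝ (Fin 3) := !₂[1 / 2, Real.sqrt 3 / 2, 0]

/-- `e₃ = (2√6/3)(0, 0, 1)` (7) — twice the ideal layer spacing `√(2/3)`. [cite: CicaleseKreutzLeonardi2023, (7), p. 5] -/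
def hcpE₃ : EuclideanSpace ℝ (Fin 3) := !₂[0, 0, 2 * Real.sqrt 6 / 3]

/-- `v₁ = ⅓(e₁ + e₂) + ½ e₃ = (½, √3/6, √(2/3))` (7), the shift of the `B` layers.
[cite: CicaleseKreutzLeonardi2023, (7), p. 5] -/
def hcpV₁ : EuclideanSpace ℝ (Fin 3) := (1 / 3 : ℝ) • (hcpE₁ + hcpE₂) + (1 / 2 : ℝ) • hcpE₃

/-- **The hcp surface energy density in deficiency units**, `φ_hcp := ϕ_HCP/2` with the printed (26)
`ϕ_HCP(ν) = √2(|⟨e₁,ν⟩| + |⟨e₂,ν⟩| + |⟨e₁−e₂,ν⟩|) + (1/√2)|⟨e₃,ν⟩| + √2 max{|⟨e₁,ν⟩|,|⟨e₂,ν⟩|,|⟨e₃,ν⟩|,|⟨e₁−e₂,ν⟩|}`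
(the factor `½` is the tree's normalisation `phiFcc = ϕ_FCC/2`, see `FccSurfaceTension.lean`).  Defined on
all of `ℝ³`, positively one-homogeneous. [cite: CicaleseKreutzLeonardi2023, Proposition 2.5 (26), p. 10] -/
def phiHcp (ν : EuclideanSpace ℝ (Fin 3)) : ℝ :=
  (Real.sqrt 2 * (|⟪hcpE₁, ν⟫| + |⟪hcpE₂, ν⟫| + |⟪hcpE₁ - hcpE₂, ν⟫|) +
      (Real.sqrt 2)⁻¹ * |⟪hcpE₃, ν⟫| +
      Real.sqrt 2 * max (max |⟪hcpE₁, ν⟫| |⟪hcpE₂, ν⟫|) (max |⟪hcpE₃, ν⟫| |⟪hcpE₁ - hcpE₂, ν⟫|)) / 2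

/-- `φ_hcp ≥ 0`. [cite: CicaleseKreutzLeonardi2023, (19)–(20), p. 7] -/
theorem phiHcp_nonneg (ν : EuclideanSpace ℝ (Fin 3)) : 0 ≤ phiHcp ν := by
  unfold phiHcp
  positivity

/-- `φ_hcp(−ν) = φ_hcp(ν)`. [cite: CicaleseKreutzLeonardi2023, Proposition 2.5 (26), p. 10] -/
theorem phiHcp_neg (ν : EuclideanSpace ℝ (Fin 3)) : phiHcp (-ν) = phiHcp ν := by
  simp only [phiHcp, inner_neg_right, abs_neg]

/-! ### Minimisers and empirical measures -/

/-- `X` **minimises the sticky energy on the host `L` among configurations with the same number of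
points**: `X ⊂ L` and `D(X) ≤ D(Y)` for every `Y ⊂ L` with `#Y = #X`, `D = contactDeficiency`
(`Σ_{x∈X}(12 − #(N(x)∩X)) = 2D(X)`, so this is "`E_{L,ε}(μ_ε) = inf` over measures of the same mass",
Theorem 2.3 (i), equivalently "`F_ε(X_ε) = min_{#X = n_ε} F_ε(X)`", Lemma 5.16).
[cite: CicaleseKreutzLeonardi2023, Theorem 2.3 (i), p. 8; Lemma 5.16, p. 36] -/
def IsDeficiencyMinimizer (L : Set (EuclideanSpace ℝ (Fin 3))) (X : Finset (EuclideanSpace ℝ (Fin 3))) :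
    Prop :=
  (↑X : Set (EuclideanSpace ℝ (Fin 3))) ⊆ L ∧
    ∀ Y : Finset (EuclideanSpace ℝ (Fin 3)), (↑Y : Set (EuclideanSpace ℝ (Fin 3))) ⊆ L →
      Y.card = X.card → contactDeficiency X ≤ contactDeficiency Y

/-- **Weak-star convergence of the translated, rescaled empirical measures to `ρ χ_W 𝓛³`:** for the
configurations `X_k ⊂ L` (unscaled), scales `ε_k` and translations `a_k`, the measures
`μ_k = ε_k³ Σ_{x∈X_k} δ_{ε_k(x − a_k)}` (the source's `μ_ε(· − τ_ε)`, `τ_ε = −ε a`, (17)) satisfy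
`∫ g dμ_k → ρ ∫_W g` for every continuous compactly supported `g : ℝ³ → ℝ` (weak star convergence, p. 4).
[cite: CicaleseKreutzLeonardi2023, (17) p. 7, p. 4, Lemma 5.16 p. 36] -/
def EmpiricalMeasuresConvergeTo (X : ℕ → Finset (EuclideanSpace ℝ (Fin 3))) (ε : ℕ → ℝ)
    (a : ℕ → EuclideanSpace ℝ (Fin 3)) (W : Set (EuclideanSpace ℝ (Fin 3))) (ρ : ℝ) : Prop :=
  ∀ g : EuclideanSpace ℝ (Fin 3) → ℝ, Continuous g → HasCompactSupport g →
    Tendsto (fun k : ℕ => (ε k) ^ 3 * ∑ x ∈ X k, g ((ε k) • (x - a k))) atTop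
      (𝓝 (ρ * ∫ y in W, g y))

/-! ### The named facts -/

/-- **Cicalese–Kreutz–Leonardi 2023, Theorem 2.3 (i) (second part) with Lemma 5.16, host `L_FCC`,
NAMED FACT — emergence of the Wulff crystal.**  Let `ε_k → 0` (`ε_k > 0`), `v > 0`, and let
`X_k ⊂ L_FCC = span_ℤ{(0,1,1)/√2, (1,0,1)/√2, (1,1,0)/√2}` be finite configurations with `ε_k³ #X_k → √2 v`,
each maximising the number of contacts (minimising the deficiency) among configurations of `#X_k` points
of `L_FCC`.  Then there are lattice translations `a_k ∈ L_FCC` such that the empirical measures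
`ε_k³ Σ_{x∈X_k} δ_{ε_k(x − a_k)}` converge weakly-star to `√2 χ_{W^v} 𝓛³`, where `W^v` is the dilate of
volume `v` of the Wulff set `W_{φ_fcc} = {ζ : ⟨ζ,ν⟩ ≤ φ_fcc(ν) ∀ ν ∈ S²}` of the fcc density (23)
(a truncated octahedron, Proposition 2.4).
[cite: CicaleseKreutzLeonardi2023, Theorem 2.3 (i) p. 8–9; Lemma 5.16 p. 36; (22) p. 8; (8) p. 5] -/
def CicaleseKreutzLeonardi2023_fccWulffEmergence : Prop :=
  ∀ (X : ℕ → Finset (EuclideanSpace ℝ (Fin 3))) (ε : ℕ → ℝ) (v : ℝ), 0 < v → (∀ k, 0 < ε k) →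
    Tendsto ε atTop (𝓝 0) →
    Tendsto (fun k => (ε k) ^ 3 * ((X k).card : ℝ)) atTop (𝓝 (Real.sqrt 2 * v)) →
    (∀ k, IsDeficiencyMinimizer fccLattice (X k)) →
      ∃ a : ℕ → EuclideanSpace ℝ (Fin 3), (∀ k, a k ∈ fccLattice) ∧
        EmpiricalMeasuresConvergeTo X ε a (volumeDilate (wulffSet phiFcc) v) (Real.sqrt 2)

/-- **Cicalese–Kreutz–Leonardi 2023, Theorem 2.3 (i) (second part) with Lemma 5.16, host `L_HCP`,
NAMED FACT — emergence of the Wulff crystal.**  Let `ε_k → 0` (`ε_k > 0`), `v > 0`, and let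
`X_k ⊂ L_HCP = hcpStacking 1 √(2/3)` (`= span_ℤ{e₁,e₂,e₃} ∪ (span_ℤ{e₁,e₂,e₃} + v₁)`, (9)) be finite
configurations with `ε_k³ #X_k → √2 v`, each minimising the deficiency among configurations of `#X_k`
points of `L_HCP`.  Then there are translations `a_k ∈ span_ℤ{e₁, e₂, e₃}` such that
`ε_k³ Σ_{x∈X_k} δ_{ε_k(x − a_k)} ⇀* √2 χ_{W^v} 𝓛³`, `W^v` the dilate of volume `v` of the Wulff set of the
hcp density (26) ("a truncated elongated hexagonal bipyramid", Proposition 2.5).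
[cite: CicaleseKreutzLeonardi2023, Theorem 2.3 (i) p. 8–9; Lemma 5.16 p. 36; (22) p. 8; (9) p. 5; (26) p. 10] -/
def CicaleseKreutzLeonardi2023_hcpWulffEmergence : Prop :=
  ∀ (X : ℕ → Finset (EuclideanSpace ℝ (Fin 3))) (ε : ℕ → ℝ) (v : ℝ), 0 < v → (∀ k, 0 < ε k) →
    Tendsto ε atTop (𝓝 0) →
    Tendsto (fun k => (ε k) ^ 3 * ((X k).card : ℝ)) atTop (𝓝 (Real.sqrt 2 * v)) →
    (∀ k, IsDeficiencyMinimizer (hcpStacking 1 (√(2 / 3))) (X k)) →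
      ∃ a : ℕ → EuclideanSpace ℝ (Fin 3),
        (∀ k, a k ∈ (Submodule.span ℤ ({hcpE₁, hcpE₂, hcpE₃} : Set (EuclideanSpace ℝ (Fin 3))) :
            Set (EuclideanSpace ℝ (Fin 3)))) ∧
        EmpiricalMeasuresConvergeTo X ε a (volumeDilate (wulffSet phiHcp) v) (Real.sqrt 2)

/-! ### The `N`-indexed form (`ε = N^{−1/3}`, `v = 1/√2`), proved from the named fact -/

/-- **Corollary (PROVED from the fcc named fact): the `N`-indexed Wulff-crystal statement.**  For
`N`-point contact maximisers `X_N ⊂ L_FCC` (`#X_N = N + 1` to keep `ε_N = (N+1)^{−1/3} > 0`), there are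
`a_N ∈ L_FCC` with `(N+1)^{−1} Σ_{x∈X_N} g((N+1)^{−1/3}(x − a_N)) → √2 ∫_{W} g` for all `g ∈ C_c(ℝ³)`, `W`
the dilate of `W_{φ_fcc}` of volume `1/√2` (so that `√2 χ_W 𝓛³` is a probability measure) — the case
`ε³ n_ε = 1`, `v = 1/√2` of Theorem 2.3 (i). [cite: CicaleseKreutzLeonardi2023, Theorem 2.3 (i), p. 8–9] -/
theorem fccWulffEmergence_nat_of (h : CicaleseKreutzLeonardi2023_fccWulffEmergence)
    (X : ℕ → Finset (EuclideanSpace ℝ (Fin 3))) (hcard : ∀ N, (X N).card = N + 1)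
    (hmin : ∀ N, IsDeficiencyMinimizer fccLattice (X N)) :
    ∃ a : ℕ → EuclideanSpace ℝ (Fin 3), (∀ N, a N ∈ fccLattice) ∧
      EmpiricalMeasuresConvergeTo X (fun N => ((N : ℝ) + 1) ^ (-(1 / 3 : ℝ))) a
        (volumeDilate (wulffSet phiFcc) (Real.sqrt 2)⁻¹) (Real.sqrt 2) := by
  have hpos : ∀ N : ℕ, (0 : ℝ) < (N : ℝ) + 1 := fun N => by positivity
  refine h X _ _ (by positivity) (fun N => Real.rpow_pos_of_pos (hpos N) _) ?_ ?_ hmin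
  · have h1 : Tendsto (fun N : ℕ => (N : ℝ) + 1) atTop atTop :=
      tendsto_atTop_add_const_right _ 1 tendsto_natCast_atTop_atTop
    exact (tendsto_rpow_neg_atTop (by norm_num : (0 : ℝ) < 1 / 3)).comp h1
  · have hconst : (fun N : ℕ => (((N : ℝ) + 1) ^ (-(1 / 3 : ℝ))) ^ 3 * ((X N).card : ℝ)) =
        fun _ => Real.sqrt 2 * (Real.sqrt 2)⁻¹ := by
      funext N
      rw [mul_inv_cancel₀ (Real.sqrt_ne_zero'.mpr (by norm_num : (0 : ℝ) < 2)), hcard N,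
        ← Real.rpow_natCast, ← Real.rpow_mul (hpos N).le]
      norm_num
      rw [Real.rpow_neg_one]
      exact inv_mul_cancel₀ (hpos N).ne'
    rw [hconst]
    exact tendsto_const_nhds


/-- **Corollary (PROVED from the hcp named fact): the `N`-indexed Wulff-crystal statement on `L_HCP`**
(`#X_N = N + 1`, `ε_N = (N+1)^{−1/3}`, `v = 1/√2`), the hcp twin of `fccWulffEmergence_nat_of`.
[cite: CicaleseKreutzLeonardi2023, Theorem 2.3 (i), p. 8–9] -/
theorem hcpWulffEmergence_nat_of (h : CicaleseKreutzLeonardi2023_hcpWulffEmergence)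
    (X : ℕ → Finset (EuclideanSpace ℝ (Fin 3))) (hcard : ∀ N, (X N).card = N + 1)
    (hmin : ∀ N, IsDeficiencyMinimizer (hcpStacking 1 (√(2 / 3))) (X N)) :
    ∃ a : ℕ → EuclideanSpace ℝ (Fin 3),
      (∀ N, a N ∈ (Submodule.span ℤ ({hcpE₁, hcpE₂, hcpE₃} : Set (EuclideanSpace ℝ (Fin 3))) :
          Set (EuclideanSpace ℝ (Fin 3)))) ∧
      EmpiricalMeasuresConvergeTo X (fun N => ((N : ℝ) + 1) ^ (-(1 / 3 : ℝ))) a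
        (volumeDilate (wulffSet phiHcp) (Real.sqrt 2)⁻¹) (Real.sqrt 2) := by
  have hpos : ∀ N : ℕ, (0 : ℝ) < (N : ℝ) + 1 := fun N => by positivity
  refine h X _ _ (by positivity) (fun N => Real.rpow_pos_of_pos (hpos N) _) ?_ ?_ hmin
  · have h1 : Tendsto (fun N : ℕ => (N : ℝ) + 1) atTop atTop :=
      tendsto_atTop_add_const_right _ 1 tendsto_natCast_atTop_atTop
    exact (tendsto_rpow_neg_atTop (by norm_num : (0 : ℝ) < 1 / 3)).comp h1
  · have hconst : (fun N : ℕ => (((N : ℝ) + 1) ^ (-(1 / 3 : ℝ))) ^ 3 * ((X N).card : ℝ)) =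
        fun _ => Real.sqrt 2 * (Real.sqrt 2)⁻¹ := by
      funext N
      rw [mul_inv_cancel₀ (Real.sqrt_ne_zero'.mpr (by norm_num : (0 : ℝ) < 2)), hcard N,
        ← Real.rpow_natCast, ← Real.rpow_mul (hpos N).le]
      norm_num
      rw [Real.rpow_neg_one]
      exact inv_mul_cancel₀ (hpos N).ne'
    rw [hconst]
    exact tendsto_const_nhds

/-! ### A consistency check of the transcription of (26) -/

/-- **The basal facet of hcp costs `√3` per unit area in deficiency units** — the same as a `{111}` facet
of fcc (`phiFcc_111`: `φ_fcc(1,1,1) = 3 = √3·‖(1,1,1)‖`): `φ_hcp(e_z) = ½ ϕ_HCP(e_z) = ½(0 + (1/√2)(2√6/3)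
+ √2(2√6/3)) = √3`.  (Both facets are close-packed triangular layers losing three bonds per atom.)
[cite: CicaleseKreutzLeonardi2023, Proposition 2.5 (26), p. 10] -/
theorem phiHcp_basal : phiHcp (EuclideanSpace.single 2 1) = Real.sqrt 3 := by
  have h6 : Real.sqrt 6 = Real.sqrt 2 * Real.sqrt 3 := by
    rw [← Real.sqrt_mul (by norm_num : (0 : ℝ) ≤ 2)]; norm_num
  have hs2 : Real.sqrt 2 * Real.sqrt 2 = 2 := Real.mul_self_sqrt (by norm_num)
  have h2 : 0 < Real.sqrt 2 := Real.sqrt_pos.mpr (by norm_num)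
  have h3 : 0 < Real.sqrt 3 := Real.sqrt_pos.mpr (by norm_num)
  have e1 : ⟪hcpE₁, EuclideanSpace.single (2 : Fin 3) (1 : ℝ)⟫ = 0 := by
    simp [hcpE₁, EuclideanSpace.inner_single_right]
  have e2 : ⟪hcpE₂, EuclideanSpace.single (2 : Fin 3) (1 : ℝ)⟫ = 0 := by
    simp [hcpE₂, EuclideanSpace.inner_single_right]
  have e12 : ⟪hcpE₁ - hcpE₂, EuclideanSpace.single (2 : Fin 3) (1 : ℝ)⟫ = 0 := by
    rw [inner_sub_left, e1, e2, sub_zero]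
  have e3 : ⟪hcpE₃, EuclideanSpace.single (2 : Fin 3) (1 : ℝ)⟫ = 2 * Real.sqrt 6 / 3 := by
    simp [hcpE₃, EuclideanSpace.inner_single_right]
  have hpos : 0 < 2 * Real.sqrt 6 / 3 := by positivity
  rw [phiHcp, e1, e2, e12, e3, abs_zero, abs_of_pos hpos, max_self, max_eq_left hpos.le,
    max_eq_right hpos.le, h6]
  field_simp
  nlinarith [hs2, h2, h3]

/-! ### The Wulff set of `φ_fcc` IS the truncated octahedron (PROVED) -/

/-- **"`W_FCC` is a truncated octahedron" (Proposition 2.4), PROVED:** the Wulff set (22) of the fcc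
density `φ_fcc` (= `ϕ_FCC/2`) is exactly the tree's `fccWulffBody = conv{perm(0, ±1, ±2)}` — `⊇` is
`fccWulffBody_subset_wulffSet`; for `⊆`, a point outside the compact convex body is strictly separated from
it by a linear functional `⟨·, ν⟩` (Hahn–Banach), whose maximum over the body is `φ_fcc(ν)`
(`isGreatest_inner_fccWulffBody`), contradicting the defining inequality of `W_{φ_fcc}` at `ν/|ν|`
(one-homogeneity `phiFcc_smul`).  Hence the volume-`v` Wulff crystal of the named facts is the dilate of
the explicit polytope `fccWulffBody` (volume `32` at this normalisation; `2·fccWulffBody` is the source's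
`W_FCC` for `ϕ_FCC`). [cite: CicaleseKreutzLeonardi2023, Proposition 2.4 (22)–(24), p. 8–10] -/
theorem wulffSet_phiFcc_eq_fccWulffBody : wulffSet phiFcc = fccWulffBody := by
  refine Set.Subset.antisymm (fun ζ hζ => ?_) fccWulffBody_subset_wulffSet
  by_contra hnot
  have hconv : Convex ℝ fccWulffBody := by
    rw [fccWulffBody]
    exact convex_convexHull ℝ _
  have hclosed : IsClosed fccWulffBody := by
    rw [fccWulffBody]
    exact ((Set.toFinite _).isCompact_convexHull ℝ).isClosed
  obtain ⟨f, u, hfu, hux⟩ := geometric_hahn_banach_closed_point hconv hclosed hnot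
  set ν : EuclideanSpace ℝ (Fin 3) := (InnerProductSpace.toDual ℝ (EuclideanSpace ℝ (Fin 3))).symm f
    with hν
  have hf : ∀ y : EuclideanSpace ℝ (Fin 3), f y = ⟪y, ν⟫ := fun y => by
    rw [hν, real_inner_comm, InnerProductSpace.toDual_symm_apply]
  obtain ⟨⟨y₀, hy₀, hy₀ν⟩, -⟩ := isGreatest_inner_fccWulffBody ν
  have hy₀ν' : ⟪y₀, ν⟫ = phiFcc ν := hy₀ν
  have h1 : phiFcc ν < u := by
    rw [← hy₀ν', ← hf]
    exact hfu y₀ hy₀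
  have h2 : u < ⟪ζ, ν⟫ := by
    rw [← hf]
    exact hux
  have hν0 : ν ≠ 0 := by
    rintro h0
    rw [h0, inner_zero_right] at h2
    rw [h0, (phiFcc_eq_zero_iff 0).2 rfl] at h1
    linarith
  have hnorm : 0 < ‖ν‖ := norm_pos_iff.2 hν0
  have hunit : ‖(‖ν‖⁻¹ : ℝ) • ν‖ = 1 := by
    rw [norm_smul, norm_inv, norm_norm, inv_mul_cancel₀ hnorm.ne']
  have hζ' := hζ ((‖ν‖⁻¹ : ℝ) • ν) hunit
  rw [real_inner_smul_right, phiFcc_smul, abs_of_pos (inv_pos.2 hnorm)] at hζ'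
  have h3 : ⟪ζ, ν⟫ ≤ phiFcc ν := le_of_mul_le_mul_left hζ' (inv_pos.2 hnorm)
  linarith

/-- Consequently the volume-`v` fcc Wulff crystal of the named facts is the volume-`v` dilate of the
explicit truncated octahedron `fccWulffBody`. [cite: CicaleseKreutzLeonardi2023, Proposition 2.4, p. 10] -/
theorem volumeDilate_wulffSet_phiFcc (v : ℝ) :
    volumeDilate (wulffSet phiFcc) v = volumeDilate fccWulffBody v := by
  rw [wulffSet_phiFcc_eq_fccWulffBody]

end Literature.MathematicalPhysics.StatisticalMechanics

end
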